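import Literature.AlgebraicGeometry.Frobenioids.PrimesEquivPreStep
import Literature.AlgebraicGeometry.Frobenioids.PrimaryDvdTotalWeak
import HarnessLib

/-!
# [FrdI] Theorem 4.2 (ii): the bijection `Ψ^Prime(A)` and its functoriality along pre-steps — for WEAKLY
# perf-factorial divisor monoids

Mochizuki, *The geometry of Frobenioids I: the general theory*, Kyushu J. Math. **62** (2008) 293–400, §4,
Theorem 4.2 (ii), statement p. 77, proof p. 80 l. 18 – p. 81 l. 4 (kurims) [cite: MochizukiFrdI2008, Thm. 4.2 (ii) p.77];
Prop. 4.1 (iii) p. 75 [cite: MochizukiFrdI2008, Prop. 4.1 (iii) p.75]; Def. 2.4 (i) p. 47 [cite: MochizukiFrdI2008, Def. 2.4 (i) p.47].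

PROOF-ONLY file (cell abc-iut, layer L1, node `FrdI:Thm4.2`; seat abc-iut-L1-t12, holder of the row «Thm. 4.2 chain
over `IsPerfFactorialWeak`», L1-lead R129).  Verbatim ports, with the hypothesis `Objectwise IsPerfFactorial`
replaced by `Objectwise IsPerfFactorialWeak` (Def. 2.4 (i) (a)(b)(c) + (d_ord) + (d_res) — the notion available
at the tempered Frobenioids of [EtTh] §3 over objects with infinitely many special-fibre components; printed case
via `IsPerfFactorial.weak`), of the tree's Thm. 4.2 (ii) engine (seats abc-iut-L1-t14 / w4-d090):
* `IsPerfFactorialWeak.exists_split_at_prime` — the splitting of an element at a prime (Def. 2.4 (i)(c), (d_res));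
* `PreFrobenioid.exists_common_prime_iff_not_isCoprimary_weak` — two primary steps into `A` have their `x` in a
  common prime iff they are not co-primary (Prop. 4.1 (iii); port of `PrimaryStepsPrimeClasses.lean`);
* `PreFrobenioid.existsUnique_primesEquiv_weak` — Thm. 4.2 (ii) at an object: the unique bijection
  `Ψ^Prime_A : Prime(Φ₁(A)) ≃ Prime(Φ₂(Ψ A))` carrying the prime of `x_ε` to that of `x_{Ψ ε}` (port of
  `PrimaryStepsTransport.lean`);
* `PreFrobenioid.primes_compat_preStep_of_forall_not_dvd_weak`, `PreFrobenioid.primesEquiv_naturality_preStep_mem_weak`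
  — functoriality of `Ψ^Prime` along pre-steps (the co-primary case and the assembly; the same-prime case
  `primes_compat_preStep_of_mem` of `PrimesEquivPreStep.lean` uses no perf-factoriality and is consumed BY NAME).
The perf-factoriality enters only through `IsPerfFactorialWeak.exists_common_prime_iff` (abc-iut-L2-d2,
`PrimaryDvdTotalWeak.lean`), `mul_dvd_of_forall_common_dvd_eq_one`, `exists_split`, `precsim_of_factorMap_eq_mulSingle`,
`not_dvd_of_factorMap_apply_eq_one` (abc-iut-L1-t2, `PerfFactorialWeak(Coprime).lean`).  No new definitions; no landed
declaration touched; nothing of the paper is restated or strengthened.  HONEST FRAMING: classical [FrdI] §4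
algebra; nothing here bears on [IUTchIII] Cor. 3.12.
-/

namespace Literature.AlgebraicGeometry.Frobenioids

open CategoryTheory Opposite

/-! ### Monoid lemma (Def. 2.4 (i)): the splitting at a prime, weak hypothesis -/

section Monoid

universe uM

variable {M : Type uM} [CommMonoid M]

/-- **The splitting at a prime** (Def. 2.4 (i)(c) and (d_res), "the primary factorizations", pp. 76–77) in a
perfect WEAKLY perf-factorial monoid `M` (through `M ⥲ M^pf`): every `y` is `c · r` with `c = 0` or `c ∈ 𝔭`, and
`r` divisible by no element of `𝔭` — port of `IsPerfFactorial.exists_split_at_prime` (seat abc-iut-w4-d090).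
[cite: MochizukiFrdI2008, Def. 2.4 (i) p.47] -/
theorem IsPerfFactorialWeak.exists_split_at_prime (h : IsPerfFactorialWeak M) (hperf : IsPerfect M) (y : M)
    (𝔭 : Primes M) :
    ∃ c r : M, c * r = y ∧ (c = 1 ∨ c ∈ 𝔭.carrier) ∧ ∀ d ∈ 𝔭.carrier, ¬ d ∣ r := by
  classical
  have hM : IsSharp M := h.isDivisorial.isSharp
  have hbij := isPerfect_iff_bijective_of.mp hperf
  obtain ⟨⟨p, hpP⟩, hp𝔭'⟩ := Quotient.exists_rep 𝔭
  have hp : p ∈ 𝔭.carrier := ⟨hpP, hp𝔭'⟩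
  have hpprim : IsPrimary (Perfection.of M p) := (Perfection.isPrimary_of_iff hM).mpr hp.1
  let 𝔮 : Primes (Perfection M) := Quotient.mk _ ⟨Perfection.of M p, hpprim⟩
  have hp𝔮 : Perfection.of M p ∈ 𝔮.carrier := mem_carrier_mk_of_isPrimary hpprim
  have hmem : ∀ d ∈ 𝔭.carrier, Perfection.of M d ∈ 𝔮.carrier := fun d hd =>
    𝔮.mem_carrier_of_precsim hp𝔮 (fun e => hd.1.1 (hbij.1 (by rw [e, map_one])))
      (Precsim.map (Perfection.of M) (𝔭.precsim_of_mem_carrier hd hp))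
  obtain ⟨y₁, y₂, x₁, hy, hy₁, hy₂⟩ := h.exists_split (Perfection.of M y) 𝔮
  obtain ⟨c, rfl⟩ := hbij.2 y₁
  obtain ⟨r, rfl⟩ := hbij.2 y₂
  refine ⟨c, r, hbij.1 (by rw [map_mul, hy]), ?_, fun d hd hdr => ?_⟩
  · by_cases hc : c = 1
    · exact Or.inl hc
    · refine Or.inr (𝔭.mem_carrier_of_precsim hp hc ?_)
      exact Perfection.of_precsim_of_iff.mp (h.precsim_of_factorMap_eq_mulSingle hp𝔮 x₁ hy₁)
  · exact h.not_dvd_of_factorMap_apply_eq_one (hmem d hd) hy₂ (map_dvd (Perfection.of M) hdr)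

end Monoid

namespace PreFrobenioid

universe w v v' u u' w₂ v₂ v₂' u₂ u₂'

variable {D : Type u} [Category.{v} D] {Φ : Dᵒᵖ ⥤ CommMonCat.{w}}
  {C : Type u'} [Category.{v'} C] {F : C ⥤ ElemFrobenioid Φ}

/-! ### One Frobenioid: primary steps into `A` modulo "not co-primary", weak hypothesis -/

/-- **Theorem 4.2 (ii), first step, weakly perf-factorial divisor monoids** (Prop. 4.1 (iii); Def. 2.4 (i)(b)):
for a Frobenioid of isotropic type and primary steps `ε : E → A`, `ι : I → A`, the primary elements `x_ε`, `x_ι` of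
`Φ(A)` lie in a COMMON prime iff `ε`, `ι` are NOT co-primary — port of `exists_common_prime_iff_not_isCoprimary`
(seat abc-iut-L1-t14) over `IsPerfFactorialWeak.exists_common_prime_iff`. [cite: MochizukiFrdI2008, Thm. 4.2 (ii) p.77] -/
theorem exists_common_prime_iff_not_isCoprimary_weak (hF : IsFrobenioid F) (histr : IsOfIsotropicType F)
    (hpf : Objectwise (fun M _ => IsPerfFactorialWeak M) Φ) {E I A : C} {ε : E ⟶ A} {ι : I ⟶ A}
    (hε : IsPrimaryPreStep F ε) (hι : IsPrimaryPreStep F ι) :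
    (∃ 𝔭 : Primes (Φ.obj (op (baseObj F A))),
        invDiv F ε hε.1.2 ∈ 𝔭.carrier ∧ invDiv F ι hι.1.2 ∈ 𝔭.carrier) ↔
      ¬ ∀ ⦃Z : C⦄ (ζ : Z ⟶ A), IsPreStep F ζ →
        (∃ (ε' : E ⟶ Z) (ι' : I ⟶ Z), IsPreStep F ε' ∧ IsPreStep F ι' ∧ ε' ≫ ζ = ε ∧ ι' ≫ ζ = ι) →
          IsIso ζ := by
  rw [isCoprimary_iff_forall_dvd hF histr hε.1 hι.1,
    (hpf (baseObj F A)).exists_common_prime_iff (isPrimary_invDiv hε) (isPrimary_invDiv hι)]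
  constructor
  · rintro ⟨z, hz1, hzε, hzι⟩ hall
    exact hz1 (hall z hzε hzι)
  · intro hn
    by_contra hc
    push Not at hc
    exact hn fun z hzε hzι => by_contra fun hz1 => hc z hz1 hzε hzι

/-! ### Two Frobenioids -/

variable {D₂ : Type u₂} [Category.{v₂} D₂] {Φ₂ : D₂ᵒᵖ ⥤ CommMonCat.{w₂}}
  {C₂ : Type u₂'} [Category.{v₂'} C₂] {F₂ : C₂ ⥤ ElemFrobenioid Φ₂} (Ψ : C ≌ C₂)

set_option backward.isDefEq.respectTransparency false in
/-- **Theorem 4.2 (ii) at an object, weakly perf-factorial divisor monoids** (FrdI pp. 77–79): for Frobenioids of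
isotropic type and an equivalence `Ψ` which, together with `Ψ⁻¹`, preserves pre-steps [Thm. 3.4 (ii)] and primary
pre-steps into `A` resp. `Ψ(A)` [Thm. 4.2 (i)], there is a UNIQUE bijection `Ψ^Prime_A : Prime(Φ₁(A)) ≃ Prime(Φ₂(Ψ A))`
carrying the prime of `x_ε` to the prime of `x_{Ψ(ε)}` for every primary pre-step `ε : E → A` — port of
`existsUnique_primesEquiv` (seat abc-iut-L1-t14). [cite: MochizukiFrdI2008, Thm. 4.2 (ii) p.77] -/
theorem existsUnique_primesEquiv_weak (hF : IsFrobenioid F) (hF₂ : IsFrobenioid F₂)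
    (histr : IsOfIsotropicType F) (histr₂ : IsOfIsotropicType F₂)
    (hpf : Objectwise (fun M _ => IsPerfFactorialWeak M) Φ)
    (hpf₂ : Objectwise (fun M _ => IsPerfFactorialWeak M) Φ₂)
    (hpre : ∀ ⦃X Y : C⦄ (φ : X ⟶ Y), IsPreStep F φ → IsPreStep F₂ (Ψ.functor.map φ))
    (hpre' : ∀ ⦃X Y : C₂⦄ (φ : X ⟶ Y), IsPreStep F₂ φ → IsPreStep F (Ψ.inverse.map φ))
    (A : C)
    (hprim : ∀ ⦃E : C⦄ (ε : E ⟶ A), IsPrimaryPreStep F ε → IsPrimaryPreStep F₂ (Ψ.functor.map ε))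
    (hprim' : ∀ ⦃Z : C₂⦄ (ξ : Z ⟶ Ψ.functor.obj A),
      IsPrimaryPreStep F₂ ξ → IsPrimaryPreStep F (Ψ.inverse.map ξ)) :
    ∃! e : Primes (Φ.obj (op (baseObj F A))) ≃ Primes (Φ₂.obj (op (baseObj F₂ (Ψ.functor.obj A)))),
      ∀ ⦃E : C⦄ (ε : E ⟶ A) (hε : IsPrimaryPreStep F ε) (𝔭 : Primes (Φ.obj (op (baseObj F A)))),
        invDiv F ε hε.1.2 ∈ 𝔭.carrier → invDiv F₂ (Ψ.functor.map ε) (hprim ε hε).1.2 ∈ (e 𝔭).carrier := by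
  classical
  have hP := hF.isPreFrobenioid
  have hP₂ := hF₂.isPreFrobenioid
  have same₁ : ∀ {E I : C} {ε : E ⟶ A} {ι : I ⟶ A} (hε : IsPrimaryPreStep F ε)
      (hι : IsPrimaryPreStep F ι),
      (∃ 𝔭 : Primes (Φ.obj (op (baseObj F A))),
          invDiv F ε hε.1.2 ∈ 𝔭.carrier ∧ invDiv F ι hι.1.2 ∈ 𝔭.carrier) ↔
        ∃ 𝔮 : Primes (Φ₂.obj (op (baseObj F₂ (Ψ.functor.obj A)))),
          invDiv F₂ (Ψ.functor.map ε) (hprim ε hε).1.2 ∈ 𝔮.carrier ∧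
            invDiv F₂ (Ψ.functor.map ι) (hprim ι hι).1.2 ∈ 𝔮.carrier := by
    intro E I ε ι hε hι
    rw [exists_common_prime_iff_not_isCoprimary_weak hF histr hpf hε hι,
      exists_common_prime_iff_not_isCoprimary_weak hF₂ histr₂ hpf₂ (hprim ε hε) (hprim ι hι),
      coprimary_map_iff Ψ hpre hpre' ε ι]
  choose Z₁ ζ₁ hζ₁ hζ₁m using exists_isPrimaryPreStep_invDiv_mem hF A
  choose Z₂ ζ₂ hζ₂ hζ₂m using exists_isPrimaryPreStep_invDiv_mem hF₂ (Ψ.functor.obj A)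
  let f : Primes (Φ.obj (op (baseObj F A))) → Primes (Φ₂.obj (op (baseObj F₂ (Ψ.functor.obj A)))) :=
    fun 𝔭 => Quotient.mk _ ⟨_, isPrimary_invDiv (hprim (ζ₁ 𝔭) (hζ₁ 𝔭))⟩
  have hf : ∀ ⦃E : C⦄ (ε : E ⟶ A) (hε : IsPrimaryPreStep F ε) (𝔭 : Primes (Φ.obj (op (baseObj F A)))),
      invDiv F ε hε.1.2 ∈ 𝔭.carrier →
        invDiv F₂ (Ψ.functor.map ε) (hprim ε hε).1.2 ∈ (f 𝔭).carrier := by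
    intro E ε hε 𝔭 hε𝔭
    obtain ⟨𝔮, h1, h2⟩ := (same₁ hε (hζ₁ 𝔭)).mp ⟨𝔭, hε𝔭, hζ₁m 𝔭⟩
    have h3 : invDiv F₂ (Ψ.functor.map (ζ₁ 𝔭)) (hprim _ (hζ₁ 𝔭)).1.2 ∈ (f 𝔭).carrier :=
      mem_carrier_mk_of_isPrimary _
    rwa [← Primes.eq_of_mem_carrier h2 h3]
  let ξ₁ : ∀ 𝔮 : Primes (Φ₂.obj (op (baseObj F₂ (Ψ.functor.obj A)))), Ψ.inverse.obj (Z₂ 𝔮) ⟶ A :=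
    fun 𝔮 => Ψ.inverse.map (ζ₂ 𝔮) ≫ Ψ.unitInv.app A
  have hξ₁ : ∀ 𝔮, IsPrimaryPreStep F (ξ₁ 𝔮) := fun 𝔮 => (hprim' _ (hζ₂ 𝔮)).comp_iso hP _
  let g : Primes (Φ₂.obj (op (baseObj F₂ (Ψ.functor.obj A)))) → Primes (Φ.obj (op (baseObj F A))) :=
    fun 𝔮 => Quotient.mk _ ⟨_, isPrimary_invDiv (hξ₁ 𝔮)⟩
  have hg : ∀ 𝔮, invDiv F (ξ₁ 𝔮) (hξ₁ 𝔮).1.2 ∈ (g 𝔮).carrier := fun 𝔮 => mem_carrier_mk_of_isPrimary _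
  have hΨξ : ∀ 𝔮, invDiv F₂ (Ψ.functor.map (ξ₁ 𝔮)) (hprim _ (hξ₁ 𝔮)).1.2 =
      invDiv F₂ (ζ₂ 𝔮) (hζ₂ 𝔮).1.2 := by
    intro 𝔮
    have e : Ψ.functor.map (ξ₁ 𝔮) = Ψ.counit.app (Z₂ 𝔮) ≫ ζ₂ 𝔮 := by
      show Ψ.functor.map (Ψ.inverse.map (ζ₂ 𝔮) ≫ Ψ.unitInv.app A) = _
      rw [Functor.map_comp, Ψ.fun_inv_map, Category.assoc, Category.assoc, Ψ.counitInv_functor_comp,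
        Category.comp_id]
    have h' : IsBaseIso F₂ (Ψ.counit.app (Z₂ 𝔮) ≫ ζ₂ 𝔮) := e ▸ (hprim _ (hξ₁ 𝔮)).1.2
    rw [show invDiv F₂ (Ψ.functor.map (ξ₁ 𝔮)) (hprim _ (hξ₁ 𝔮)).1.2 =
        invDiv F₂ (Ψ.counit.app (Z₂ 𝔮) ≫ ζ₂ 𝔮) h' from by congr 1]
    exact invDiv_iso_comp hP₂ _ _ (hζ₂ 𝔮).1.2 h'
  have hfg : ∀ 𝔮, f (g 𝔮) = 𝔮 := by
    intro 𝔮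
    have h1 := hf (ξ₁ 𝔮) (hξ₁ 𝔮) (g 𝔮) (hg 𝔮)
    rw [hΨξ] at h1
    exact Primes.eq_of_mem_carrier h1 (hζ₂m 𝔮)
  have hgf : ∀ 𝔭, g (f 𝔭) = 𝔭 := by
    intro 𝔭
    have h1 : invDiv F₂ (Ψ.functor.map (ξ₁ (f 𝔭))) (hprim _ (hξ₁ (f 𝔭))).1.2 ∈ (f 𝔭).carrier := by
      rw [hΨξ]; exact hζ₂m (f 𝔭)
    have h2 : invDiv F₂ (Ψ.functor.map (ζ₁ 𝔭)) (hprim _ (hζ₁ 𝔭)).1.2 ∈ (f 𝔭).carrier :=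
      mem_carrier_mk_of_isPrimary _
    obtain ⟨𝔭', h3, h4⟩ := (same₁ (hξ₁ (f 𝔭)) (hζ₁ 𝔭)).mpr ⟨f 𝔭, h1, h2⟩
    rw [Primes.eq_of_mem_carrier (hg (f 𝔭)) h3, Primes.eq_of_mem_carrier h4 (hζ₁m 𝔭)]
  refine ⟨⟨f, g, hgf, hfg⟩, hf, ?_⟩
  intro e' he'
  ext 𝔭 : 1
  have h1 := he' (ζ₁ 𝔭) (hζ₁ 𝔭) 𝔭 (hζ₁m 𝔭)
  have h2 : invDiv F₂ (Ψ.functor.map (ζ₁ 𝔭)) (hprim _ (hζ₁ 𝔭)).1.2 ∈ (f 𝔭).carrier :=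
    mem_carrier_mk_of_isPrimary _
  exact Primes.eq_of_mem_carrier h1 h2

/-! ### Functoriality of `Ψ^Prime` along pre-steps, weak hypothesis -/

set_option backward.isDefEq.respectTransparency false in
/-- **The co-primary case, weakly perf-factorial divisor monoids** ("the lower square is a cartesian diagram as
in Proposition 4.1, (iii)", p. 81 l. 1–2): for a pre-step `γ : A → A'` such that NO element of `𝔭'` divides `x_γ`,
and primes `𝔭 ∋ Φ₁(Base γ)(p')`, `p' ∈ 𝔭'`, there is `q' ∈ e_{A'} 𝔭'` with `Φ₂(Base Ψγ)(q') ∈ e_A 𝔭` — port of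
`primes_compat_preStep_of_forall_not_dvd` (seat abc-iut-w4-d090) over
`IsPerfFactorialWeak.mul_dvd_of_forall_common_dvd_eq_one`. [cite: MochizukiFrdI2008, Thm. 4.2 (ii) p.81] -/
theorem primes_compat_preStep_of_forall_not_dvd_weak (hF : IsFrobenioid F) (hF₂ : IsFrobenioid F₂)
    (hperf : IsOfPerfectType F) (hperf₂ : IsOfPerfectType F₂) (histr : IsOfIsotropicType F)
    (histr₂ : IsOfIsotropicType F₂) (hpf : Objectwise (fun M _ => IsPerfFactorialWeak M) Φ)
    (hpf₂ : Objectwise (fun M _ => IsPerfFactorialWeak M) Φ₂)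
    (hpre : ∀ ⦃X Y : C⦄ (φ : X ⟶ Y), IsPreStep F φ → IsPreStep F₂ (Ψ.functor.map φ))
    (hpre' : ∀ ⦃X Y : C₂⦄ (φ : X ⟶ Y), IsPreStep F₂ φ → IsPreStep F (Ψ.inverse.map φ))
    (e : ∀ A : C, Primes (Φ.obj (op (baseObj F A))) ≃ Primes (Φ₂.obj (op (baseObj F₂ (Ψ.functor.obj A)))))
    (he : ∀ (A : C) ⦃E : C⦄ (ε : E ⟶ A) (hε : IsPrimaryPreStep F ε) (𝔭 : Primes (Φ.obj (op (baseObj F A)))),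
      invDiv F ε hε.1.2 ∈ 𝔭.carrier → ∀ h₂ : IsBaseIso F₂ (Ψ.functor.map ε),
        invDiv F₂ (Ψ.functor.map ε) h₂ ∈ (e A 𝔭).carrier)
    {A A' : C} (γ : A ⟶ A') (hγ : IsPreStep F γ)
    (𝔭 : Primes (Φ.obj (op (baseObj F A)))) (𝔭' : Primes (Φ.obj (op (baseObj F A'))))
    {p' : Φ.obj (op (baseObj F A'))} (hp' : p' ∈ 𝔭'.carrier) (hpp' : pull Φ (Base F γ) p' ∈ 𝔭.carrier)
    (hnd : ∀ d ∈ 𝔭'.carrier, ¬ d ∣ invDiv F γ hγ.2) :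
    ∃ q' ∈ (e A' 𝔭').carrier, pull Φ₂ (Base F₂ (Ψ.functor.map γ)) q' ∈ (e A 𝔭).carrier := by
  have hP := hF.isPreFrobenioid
  have hP₂ := hF₂.isPreFrobenioid
  haveI : IsIso (Base F γ) := hγ.2
  obtain ⟨E, ε, hεp, hεx⟩ := exists_isPrimaryPreStep_invDiv_mem hF A' 𝔭'
  have hε : IsPreStep F ε := hεp.1
  have hdvd : ∀ x : Φ.obj (op (baseObj F A')), x ∣ invDiv F ε hε.2 → x ∣ invDiv F γ hγ.2 → x = 1 := by
    intro x hxε hxγ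
    by_contra hx
    exact hnd x (Primes.mem_carrier_of_dvd 𝔭' hεx hx hxε) hxγ
  obtain ⟨U, ε', ι', hε', hι', hsq, -, -, hdivι', -⟩ := exists_coprimary_square hF histr hε hγ
    (fun c hcε hcγ => (hpf (baseObj F A')).mul_dvd_of_forall_common_dvd_eq_one
      (isPerfect_divisorMonoid hF hperf A') hdvd hcε hcγ)
  have hxι' : invDiv F ι' hι'.2 = pull Φ (Base F γ) (invDiv F ε hε.2) :=
    invDiv_eq_pull_of_square hε.2 hι'.2 hdivι'
  obtain ⟨eγ, heγ⟩ := exists_mulEquiv_pull (Φ := Φ) (Base F γ)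
  have hxι'𝔭 : invDiv F ι' hι'.2 ∈ 𝔭.carrier := by
    rw [hxι', ← heγ]
    exact Primes.map_mem_carrier_of_mem eγ hp' (by rw [heγ]; exact hpp') hεx
  have hι'p : IsPrimaryPreStep F ι' := isPrimaryPreStep_of_isPrimary_invDiv hι' hxι'𝔭.1
  have hΨε : IsPreStep F₂ (Ψ.functor.map ε) := hpre ε hε
  have hΨγ : IsPreStep F₂ (Ψ.functor.map γ) := hpre γ hγ
  have hΨι' : IsPreStep F₂ (Ψ.functor.map ι') := hpre ι' hι'
  haveI : IsIso (Base F₂ (Ψ.functor.map γ)) := hΨγ.2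
  have hxΨε : invDiv F₂ (Ψ.functor.map ε) hΨε.2 ∈ (e A' 𝔭').carrier := he A' ε hεp 𝔭' hεx hΨε.2
  have hxΨι' : invDiv F₂ (Ψ.functor.map ι') hΨι'.2 ∈ (e A 𝔭).carrier := he A ι' hι'p 𝔭 hxι'𝔭 hΨι'.2
  have hcop : ∀ ⦃Z : C⦄ (ζ : Z ⟶ A'), IsPreStep F ζ →
      (∃ (a : E ⟶ Z) (b : A ⟶ Z), IsPreStep F a ∧ IsPreStep F b ∧ a ≫ ζ = ε ∧ b ≫ ζ = γ) → IsIso ζ :=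
    (isCoprimary_iff_forall_dvd hF histr hε hγ).mpr hdvd
  have hcop₂ := (coprimary_map_iff (F := F) (F₂ := F₂) Ψ hpre hpre' ε γ).mpr hcop
  have hdvd₂ := (isCoprimary_iff_forall_dvd hF₂ histr₂ hΨε hΨγ).mp hcop₂
  obtain ⟨U₂, ε₂', ι₂', -, hι₂', -, huniv₂, -, hdivι₂', -⟩ := exists_coprimary_square hF₂ histr₂ hΨε hΨγ
    (fun c hcε hcγ => (hpf₂ (baseObj F₂ (Ψ.functor.obj A'))).mul_dvd_of_forall_common_dvd_eq_one
      (isPerfect_divisorMonoid hF₂ hperf₂ (Ψ.functor.obj A')) hdvd₂ hcε hcγ)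
  have hxι₂' : invDiv F₂ ι₂' hι₂'.2 = pull Φ₂ (Base F₂ (Ψ.functor.map γ)) (invDiv F₂ (Ψ.functor.map ε) hΨε.2) :=
    invDiv_eq_pull_of_square hΨε.2 hι₂'.2 hdivι₂'
  obtain ⟨u, ⟨-, hu⟩, -⟩ := huniv₂ (Ψ.functor.map ε') (Ψ.functor.map ι') (hpre ε' hε') hΨι'
    (by rw [← Functor.map_comp, hsq, Functor.map_comp])
  have hcomp : IsBaseIso F₂ (u ≫ ι₂') := by rw [hu]; exact hΨι'.2
  have hdvd' : invDiv F₂ ι₂' hι₂'.2 ∣ invDiv F₂ (Ψ.functor.map ι') hΨι'.2 := by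
    have h := invDiv_dvd_invDiv_comp u ι₂' hι₂' hcomp
    rwa [RatFrac.invDiv_congr F₂ hu hcomp hΨι'.2] at h
  have hne : invDiv F₂ ι₂' hι₂'.2 ≠ 1 := by
    rw [hxι₂']
    exact pull_ne_one_of_ne_one _ hxΨε.1.1
  refine ⟨invDiv F₂ (Ψ.functor.map ε) hΨε.2, hxΨε, ?_⟩
  rw [← hxι₂']
  exact Primes.mem_carrier_of_dvd _ hxΨι' hne hdvd'

set_option backward.isDefEq.respectTransparency false in
/-- **Theorem 4.2 (ii), functoriality of `Ψ^Prime` with respect to pre-steps, weakly perf-factorial divisor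
monoids** (FrdI p. 80 l. 44 – p. 81 l. 4): every PRE-STEP `γ : A → A'` carries primes `𝔭 ⊆ Φ₁(A)`, `𝔭' ⊆ Φ₁(A')`
corresponding under `Φ₁(Base γ)` to primes corresponding under `Φ₂(Base (Ψ γ))`.  Port of
`primesEquiv_naturality_preStep_mem` (seat abc-iut-w4-d090): split `x_γ = c · r` at `𝔭'`
(`IsPerfFactorialWeak.exists_split_at_prime`), factor `γ = g ≫ ζ` with `x_ζ = c` (Def. 1.3 (iii)(d)), apply the
co-primary case to `g` and the (perf-factoriality-free) same-prime case `primes_compat_preStep_of_mem` to `ζ`.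
[cite: MochizukiFrdI2008, Thm. 4.2 (ii) p.80] -/
theorem primesEquiv_naturality_preStep_mem_weak (hF : IsFrobenioid F) (hF₂ : IsFrobenioid F₂)
    (hperf : IsOfPerfectType F) (hperf₂ : IsOfPerfectType F₂) (histr : IsOfIsotropicType F)
    (histr₂ : IsOfIsotropicType F₂) (hpf : Objectwise (fun M _ => IsPerfFactorialWeak M) Φ)
    (hpf₂ : Objectwise (fun M _ => IsPerfFactorialWeak M) Φ₂)
    (hpre : ∀ ⦃X Y : C⦄ (φ : X ⟶ Y), IsPreStep F φ → IsPreStep F₂ (Ψ.functor.map φ))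
    (hpre' : ∀ ⦃X Y : C₂⦄ (φ : X ⟶ Y), IsPreStep F₂ φ → IsPreStep F (Ψ.inverse.map φ))
    (e : ∀ A : C, Primes (Φ.obj (op (baseObj F A))) ≃ Primes (Φ₂.obj (op (baseObj F₂ (Ψ.functor.obj A)))))
    (he : ∀ (A : C) ⦃E : C⦄ (ε : E ⟶ A) (hε : IsPrimaryPreStep F ε) (𝔭 : Primes (Φ.obj (op (baseObj F A)))),
      invDiv F ε hε.1.2 ∈ 𝔭.carrier → ∀ h₂ : IsBaseIso F₂ (Ψ.functor.map ε),
        invDiv F₂ (Ψ.functor.map ε) h₂ ∈ (e A 𝔭).carrier)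
    {A A' : C} (γ : A ⟶ A') (hγ : IsPreStep F γ)
    (𝔭 : Primes (Φ.obj (op (baseObj F A)))) (𝔭' : Primes (Φ.obj (op (baseObj F A'))))
    (hrel : ∃ p' ∈ 𝔭'.carrier, pull Φ (Base F γ) p' ∈ 𝔭.carrier) :
    ∃ q' ∈ (e A' 𝔭').carrier, pull Φ₂ (Base F₂ (Ψ.functor.map γ)) q' ∈ (e A 𝔭).carrier := by
  have hP := hF.isPreFrobenioid
  have hP₂ := hF₂.isPreFrobenioid
  obtain ⟨p', hp', hpp'⟩ := hrel
  haveI : IsIso (Base F γ) := hγ.2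
  haveI : IsCancelMul (Φ.obj (op (baseObj F A'))) :=
    isIntegral_iff_isCancelMul.mp (hP.isDivisorial (baseObj F A')).isPreDivisorial.isIntegral
  have hco : ∀ {X Y : C} (f : X ⟶ Y), IsCoAngular F f :=
    fun f => isCoAngular_of_isIsotropic_codomains F f fun Z _ => histr Z
  obtain ⟨c, r, hcr, hc, hr⟩ := (hpf (baseObj F A')).exists_split_at_prime
    (isPerfect_divisorMonoid hF hperf A') (invDiv F γ hγ.2) 𝔭'
  rcases hc with hc | hc
  · subst hc
    rw [one_mul] at hcr
    subst hcr
    exact primes_compat_preStep_of_forall_not_dvd_weak Ψ hF hF₂ hperf hperf₂ histr histr₂ hpf hpf₂ hpre hpre'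
      e he γ hγ 𝔭 𝔭' hp' hpp' hr
  · obtain ⟨Z, ζ, hζco, hζx⟩ := hF.iii_d_over_surj A' c
    have hζ : IsPreStep F ζ := hζco.2
    haveI : IsIso (Base F ζ) := hζ.2
    obtain ⟨g, hgco, hgζ⟩ := hF.iii_d_over_full γ ζ ⟨hco γ, hγ⟩ hζco
      (by rw [hζx, ← hcr]; exact Dvd.intro r rfl)
    have hg : IsPreStep F g := hgco.2
    haveI : IsIso (Base F g) := hg.2
    have hγ' : IsBaseIso F (g ≫ ζ) := by rw [hgζ]; exact hγ.2
    have hxg : invDiv F g hg.2 = pull Φ (Base F ζ) r := by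
      have h1 : invDiv F (g ≫ ζ) hγ' = invDiv F γ hγ.2 := RatFrac.invDiv_congr F hgζ hγ' hγ.2
      have h2 := invDiv_comp_eq_mul g ζ hg.2 hζ hγ'
      rw [h1, ← hcr, hζx] at h2
      have h3 : r = pull Φ (inv (Base F ζ)) (invDiv F g hg.2) := mul_left_cancel h2
      rw [h3, ← pull_comp, IsIso.hom_inv_id, pull_id]
    have hpZprim : IsPrimary (pull Φ (Base F ζ) p') := (isPrimary_pull_iff (Base F ζ) p').mpr hp'.1
    let 𝔭Z : Primes (Φ.obj (op (baseObj F Z))) := Quotient.mk _ ⟨pull Φ (Base F ζ) p', hpZprim⟩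
    have hpZ : pull Φ (Base F ζ) p' ∈ 𝔭Z.carrier := mem_carrier_mk_of_isPrimary hpZprim
    obtain ⟨eζ, heζ⟩ := exists_mulEquiv_pull (Φ := Φ) (Base F ζ)
    obtain ⟨eζ', heζ'⟩ := exists_mulEquiv_pull (Φ := Φ) (inv (Base F ζ))
    have hndg : ∀ d ∈ 𝔭Z.carrier, ¬ d ∣ invDiv F g hg.2 := by
      intro d hd hdg
      have hd' : pull Φ (inv (Base F ζ)) d ∈ 𝔭'.carrier := by
        rw [← heζ']
        refine Primes.map_mem_carrier_of_mem eζ' hpZ ?_ hd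
        rw [heζ', ← pull_comp, IsIso.inv_hom_id, pull_id]
        exact hp'
      refine hr _ hd' ?_
      have := map_dvd (pull Φ (inv (Base F ζ))) hdg
      rwa [hxg, ← pull_comp, IsIso.inv_hom_id, pull_id] at this
    have hppZ : pull Φ (Base F g) (pull Φ (Base F ζ) p') ∈ 𝔭.carrier := by
      rw [← pull_comp, ← base_comp, hgζ]
      exact hpp'
    obtain ⟨qZ, hqZ, hqZA⟩ := primes_compat_preStep_of_forall_not_dvd_weak Ψ hF hF₂ hperf hperf₂ histr histr₂
      hpf hpf₂ hpre hpre' e he g hg 𝔭 𝔭Z hpZ hppZ hndg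
    have hζx' : invDiv F ζ hζ.2 ∈ 𝔭'.carrier := by
      rw [show invDiv F ζ hζ.2 = c from hζx]
      exact hc
    obtain ⟨q', hq', hq'Z⟩ := primes_compat_preStep_of_mem Ψ hF hF₂ hpre e he ζ hζ 𝔭Z 𝔭' hp' hpZ hζx'
    refine ⟨q', hq', ?_⟩
    have hΨg : IsPreStep F₂ (Ψ.functor.map g) := hpre g hg
    haveI : IsIso (Base F₂ (Ψ.functor.map g)) := hΨg.2
    obtain ⟨eg, heg⟩ := exists_mulEquiv_pull (Φ := Φ₂) (Base F₂ (Ψ.functor.map g))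
    rw [← hgζ, Functor.map_comp, base_comp, pull_comp, ← heg]
    exact Primes.map_mem_carrier_of_mem eg hqZ (by rw [heg]; exact hqZA) hq'Z

end PreFrobenioid

end Literature.AlgebraicGeometry.Frobenioids
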